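import Literature.MathematicalPhysics.QuantumManyBody.BoseGasHardCrossing
import Literature.MathematicalPhysics.QuantumManyBody.BoseGasLineGeometry
import Literature.MathematicalPhysics.QuantumManyBody.BoseGasHardLayerLines
import Literature.MathematicalPhysics.QuantumManyBody.PeriodicFormDomain
import Literature.Analysis.FunctionSpaces.TorusLineTrigSums
import HarnessLib

/-!
# Finite-energy periodic functions vanish on the hard configurations

Topic `Literature/MathematicalPhysics/QuantumManyBody`, sequel of `BoseGasHardCrossing.lean`, `BoseGasLineGeometry.lean` and
`BoseGasHardLayerLines.lean`. The line-wise form of "a finite-energy wave function vanishes on every hard sphere"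
([LSSY2005] Ch. 2 after (2.1)) for functions on the torus `(ℝ/ℤ)^{3N}` that are only absolutely continuous along
almost every coordinate line (the ACL representatives of the spectral `H¹` class, `Torus.exists_lineACL_repr`) and
have finite potential energy `∫ W(fromUnitTorusN L t) |G(t)|² dt < ∞` along almost every line:

* `lineRepr_eq_zero_of_crossing` — on a good line of particle `i` in direction `k`, the representative vanishes at
  every TRANSVERSAL crossing of a hard sphere of any image pair `(i, j, n)`;
* `volume_pairRad_eq_zero` — coincidences `xᵢ - xⱼ = Ln` form a Haar-null set of the torus;
* `ae_eq_zero_of_mem_hardLayer_zero` — **a finite-energy function vanishes a.e. on the hard configurations**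
  `fromUnitTorusN L ⁻¹' (hardLayer v L 0)`.

Tagged folklore.
-/

noncomputable section

open MeasureTheory Set Metric Filter Topology
open scoped ENNReal

namespace Literature.MathematicalPhysics.QuantumManyBody.BoseGas

-- The measure on `ℝ/ℤ` is the Haar PROBABILITY measure, as in `PeriodicFormDomain.lean`.
attribute [local instance] formDomain_measureSpace formDomain_isProbabilityMeasure formDomain_isProbabilityMeasure_pi

variable {N : ℕ} {L : ℝ} {v : ℝ → ℝ≥0∞}

/-! ### Vanishing at transversal hard crossings along good lines -/

/-- A line function with the ACL property is continuous. [folklore] -/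
theorem continuous_line_of_ACL {T : Type*} [AddCommGroup T] {G H : T → ℂ} {t : T} (e : ℝ → T)
    (hACL : ∀ a b : ℝ, IntervalIntegrable (fun x : ℝ => H (t + e x)) volume a b ∧
      G (t + e b) - G (t + e a) = ∫ x in a..b, H (t + e x)) :
    Continuous fun x : ℝ => G (t + e x) := by
  have hfun : (fun x : ℝ => G (t + e x)) = fun x => G (t + e 0) + ∫ y in (0 : ℝ)..x, H (t + e y) := by
    funext x; rw [← (hACL 0 x).2]; ring
  rw [hfun]
  exact continuous_const.add (intervalIntegral.continuous_primitive (fun a b => (hACL a b).1) 0)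

/-- **Vanishing at a transversal hard crossing on a good line.** Let particle `i` move in direction `k` through the
torus point `t` along a good line (`G` is the integral of the locally integrable `H` along it, and the line potential
energy `∫ W |G|²` is locally finite). If at the parameter `x₀` the image pair `(i, j, n)` sits exactly on a hard sphere,
`|y + L x₀ e_k| ∈ hardRad v` (`y = xᵢ - xⱼ - Ln`), transversally (`y_k + L x₀ ≠ 0`), then `G(t + x₀ 𝐞_{(i,k)}) = 0`.
[cite: LSSY2005, Ch. 2, paragraph after eq. (2.1)] -/
theorem lineRepr_eq_zero_of_crossing (hL : 0 < L) (hv : Measurable v) {i j : Fin N} (hij : i ≠ j) (k : Fin 3)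
    {G H : UnitAddTorus (Fin N × Fin 3) → ℂ} {t : UnitAddTorus (Fin N × Fin 3)}
    (hACL : ∀ a b : ℝ, IntervalIntegrable (fun x : ℝ => H (t + Pi.single (i, k) ((x : ℝ) : UnitAddCircle))) volume a b ∧
      G (t + Pi.single (i, k) ((b : ℝ) : UnitAddCircle)) - G (t + Pi.single (i, k) ((a : ℝ) : UnitAddCircle)) =
        ∫ x in a..b, H (t + Pi.single (i, k) ((x : ℝ) : UnitAddCircle)))
    (hfin : ∀ a b : ℝ, ∫⁻ x in Ioo a b, periodicInteraction v L
        (fromUnitTorusN L (t + Pi.single (i, k) ((x : ℝ) : UnitAddCircle))) *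
          ‖G (t + Pi.single (i, k) ((x : ℝ) : UnitAddCircle))‖ₑ ^ 2 ≠ ⊤)
    (n : Fin 3 → ℤ) {x₀ : ℝ}
    (hhard : ‖(fromUnitTorusN L t i - fromUnitTorusN L t j - latticeVec L n) +
        (L * x₀) • EuclideanSpace.single k (1 : ℝ)‖ ∈ hardRad v)
    (htrans : (fromUnitTorusN L t i - fromUnitTorusN L t j - latticeVec L n) k + L * x₀ ≠ 0) :
    G (t + Pi.single (i, k) ((x₀ : ℝ) : UnitAddCircle)) = 0 := by
  set X : Config N := fromUnitTorusN L t with hX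
  set y : Space := X i - X j - latticeVec L n with hy
  set ρ : ℝ → ℝ := fun x => ‖y + (L * x) • EuclideanSpace.single k (1 : ℝ)‖ with hρ
  set c : ℝ := y k + L * x₀ with hc
  have hc0 : 0 < |c| := abs_pos.2 htrans
  set δ : ℝ := |c| / (2 * L) with hδ
  have hδ0 : 0 < δ := by positivity
  have hLδ : L * δ = |c| / 2 := by rw [hδ]; field_simp
  -- sign control on `[x₀ - δ, x₀ + δ]`
  have hsign : ∀ x ∈ Icc (x₀ - δ) (x₀ + δ), |(y k + L * x) - c| ≤ |c| / 2 := by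
    intro x hx
    rw [show y k + L * x - c = L * (x - x₀) by rw [hc]; ring, abs_mul, abs_of_pos hL, ← hLδ]
    exact mul_le_mul_of_nonneg_left (abs_le.2 ⟨by linarith [hx.1], by linarith [hx.2]⟩) hL.le
  have hne : ∀ x ∈ Icc (x₀ - δ) (x₀ + δ), ρ x ≠ 0 := by
    intro x hx h0
    have h1 : 0 < |y k + L * x| := by
      have := hsign x hx
      have h2 : |c| - |y k + L * x - c| ≤ |y k + L * x| := by
        have := abs_sub_abs_le_abs_sub c (c - (y k + L * x))
        rw [sub_sub_cancel, abs_sub_comm c] at this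
        linarith
      linarith
    have h2 := abs_add_le_norm_add_smul_single y k (L * x)
    rw [show ‖y + (L * x) • EuclideanSpace.single k (1 : ℝ)‖ = ρ x from rfl, h0] at h2
    linarith
  -- the line potential dominates `v ∘ ρ`
  have hpot : ∀ x : ℝ, v (ρ x) ≤ periodicInteraction v L
      (fromUnitTorusN L (t + Pi.single (i, k) ((x : ℝ) : UnitAddCircle))) := by
    intro x
    have h1 : ρ x = pairRad L (X + (L * x) • (Pi.single i (EuclideanSpace.single k (1 : ℝ)) : Config N)) i j n := by
      rw [pairRad_add_smul_single_left L X hij k n (L * x)]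
    rw [h1, ← toUnitTorusN_smul_single hL.ne' i k x,
      (isTorusPeriodic_periodicInteraction v L).apply_fromUnitTorusN_add hL t]
    exact apply_pairRad_le_periodicInteraction v L _ hij n
  refine eq_zero_of_hardRad_of_lineEnergy_ne_top (f := fun x => G (t + Pi.single (i, k) ((x : ℝ) : UnitAddCircle)))
    (ρ := ρ) (ρ' := fun x => (y k + L * x) / ρ x * L) (K := L) hv (a := x₀ - δ) (b := x₀ + δ) (τ₀ := x₀)
    (by linarith) (by linarith) (by rw [hρ]; fun_prop) ?_ ?_ ?_ hhard ?_ ?_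
  · -- strict monotonicity
    rcases lt_or_gt_of_ne htrans with hneg | hpos
    · right
      intro a ha b hb hab
      have ha' : y k + L * a ≤ 0 := by
        have := hsign a ha; rw [abs_of_neg hneg] at this; linarith [(abs_le.1 this).2]
      have hb' : y k + L * b ≤ 0 := by
        have := hsign b hb; rw [abs_of_neg hneg] at this; linarith [(abs_le.1 this).2]
      exact strictAntiOn_norm_add_smul_single y k (show L * a ∈ Iic (-(y k)) by rw [mem_Iic]; linarith)
        (show L * b ∈ Iic (-(y k)) by rw [mem_Iic]; linarith) (mul_lt_mul_of_pos_left hab hL)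
    · left
      intro a ha b hb hab
      have ha' : 0 ≤ y k + L * a := by
        have := hsign a ha; rw [abs_of_pos hpos] at this; linarith [(abs_le.1 this).1]
      have hb' : 0 ≤ y k + L * b := by
        have := hsign b hb; rw [abs_of_pos hpos] at this; linarith [(abs_le.1 this).1]
      exact strictMonoOn_norm_add_smul_single y k (show L * a ∈ Ici (-(y k)) by rw [mem_Ici]; linarith)
        (show L * b ∈ Ici (-(y k)) by rw [mem_Ici]; linarith) (mul_lt_mul_of_pos_left hab hL)
  · -- derivative
    intro x hx
    have h1 := hasDerivAt_norm_add_smul_single y k (τ := L * x) (hne x (Ioo_subset_Icc_self hx))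
    have h2 : HasDerivAt (fun x : ℝ => L * x) L x := by simpa using (hasDerivAt_id x).const_mul L
    exact (h1.comp x h2).hasDerivWithinAt
  · -- `|ρ'| ≤ L`
    intro x _
    rw [abs_mul, abs_of_pos hL]
    exact mul_le_of_le_one_left hL.le (abs_deriv_norm_add_smul_single_le_one y k (L * x))
  · exact (continuous_line_of_ACL (G := G) (H := H) (t := t)
      (fun x : ℝ => (Pi.single (i, k) ((x : ℝ) : UnitAddCircle) : UnitAddTorus (Fin N × Fin 3))) hACL).continuousAt
  · refine ne_top_of_le_ne_top (hfin (x₀ - δ) (x₀ + δ)) (lintegral_mono fun x => ?_)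
    gcongr
    exact hpot x

/-! ### Coincidences are null; vanishing a.e. on the hard configurations -/

namespace HardLayerAux
open Literature.Analysis.FunctionSpaces

/-- The parameters at which a line of particle `i` (direction `0`) through `t` meets the coincidence set
`xᵢ - xⱼ = Ln` lie in a countable set. [folklore] -/
theorem lineSection_pairRad_eq_zero_subset (hL : 0 < L) {i j : Fin N} (hij : i ≠ j) (n : Fin 3 → ℤ)
    (t : UnitAddTorus (Fin N × Fin 3)) :
    {x : ℝ | pairRad L (fromUnitTorusN L (t + Pi.single (i, (0 : Fin 3)) ((x : ℝ) : UnitAddCircle))) i j n = 0} ⊆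
      range (fun z : ℤ => ((z : ℝ) * L - (fromUnitTorusN L t i 0 - fromUnitTorusN L t j 0)) / L) := by
  intro x hx
  rw [mem_setOf_eq] at hx
  obtain ⟨m, hm⟩ := exists_fromUnitTorusN_toUnitTorusN_eq hL
    (fromUnitTorusN L t + (L * x) • (Pi.single i (EuclideanSpace.single 0 (1 : ℝ)) : Config N))
  rw [toUnitTorusN_add, toUnitTorusN_fromUnitTorusN hL.ne', toUnitTorusN_smul_single hL.ne'] at hm
  rw [hm, pairRad_add_latticeVecN, pairRad_add_smul_single_left L _ hij, norm_eq_zero] at hx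
  have h0 := congrArg (fun z : Space => z 0) hx
  simp only [PiLp.add_apply, PiLp.sub_apply, PiLp.smul_apply, PiLp.single_apply, PiLp.zero_apply, if_true,
    latticeVec_apply, smul_eq_mul, mul_one, Pi.add_apply, Pi.sub_apply, Int.cast_add, Int.cast_sub] at h0
  refine ⟨(n - m i + m j) 0, ?_⟩
  simp only [Pi.add_apply, Pi.sub_apply, Int.cast_add, Int.cast_sub]
  field_simp
  linarith

/-- A measurable subset of the torus all of whose sections along the lines of one coordinate are countable is
Haar-null (translation–Tonelli). [folklore] -/
theorem volume_eq_zero_of_lineSection_countable (q : Fin N × Fin 3) {A : Set (UnitAddTorus (Fin N × Fin 3))}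
    (hA : MeasurableSet A)
    (h : ∀ t : UnitAddTorus (Fin N × Fin 3), ({x : ℝ | t + Pi.single q ((x : ℝ) : UnitAddCircle) ∈ A}).Countable) :
    volume A = 0 := by
  have hsec0 : ∀ t : UnitAddTorus (Fin N × Fin 3),
      ∫⁻ x in Icc (0 : ℝ) 1, A.indicator (1 : UnitAddTorus (Fin N × Fin 3) → ℝ≥0∞)
        (t + Pi.single q ((x : ℝ) : UnitAddCircle)) = 0 := by
    intro t
    refine nonpos_iff_eq_zero.1 ?_
    calc ∫⁻ x in Icc (0 : ℝ) 1, A.indicator (1 : UnitAddTorus (Fin N × Fin 3) → ℝ≥0∞)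
          (t + Pi.single q ((x : ℝ) : UnitAddCircle))
        ≤ ∫⁻ x : ℝ, A.indicator (1 : UnitAddTorus (Fin N × Fin 3) → ℝ≥0∞) (t + Pi.single q ((x : ℝ) : UnitAddCircle)) :=
          setLIntegral_le_lintegral _ _
      _ ≤ ∫⁻ x : ℝ, ({x : ℝ | t + Pi.single q ((x : ℝ) : UnitAddCircle) ∈ A}).indicator (1 : ℝ → ℝ≥0∞) x := by
          refine lintegral_mono fun x => ?_
          by_cases hx : t + Pi.single q ((x : ℝ) : UnitAddCircle) ∈ A
          · have hx' : x ∈ {x : ℝ | t + Pi.single q ((x : ℝ) : UnitAddCircle) ∈ A} := hx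
            rw [indicator_of_mem hx, indicator_of_mem hx', Pi.one_apply, Pi.one_apply]
          · rw [indicator_of_notMem hx]; exact zero_le
      _ = 0 := by rw [lintegral_indicator_one (h t).measurableSet, (h t).measure_zero]
  have hT := Torus.lintegral_lintegral_line_eq q (measurable_one.indicator hA) 0 1
  simp only [hsec0, lintegral_zero, sub_zero, ENNReal.ofReal_one, one_mul, lintegral_indicator_one hA] at hT
  exact hT.symm

/-- **Coincidences are Haar-null**: for `i ≠ j` and a lattice image `n`, the torus points with `xᵢ - xⱼ = Ln`
(`pairRad = 0`) form a null set (each line of particle `i` meets them in countably many parameters). [folklore] -/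
theorem volume_pairRad_eq_zero (hL : 0 < L) {i j : Fin N} (hij : i ≠ j) (n : Fin 3 → ℤ) :
    volume {t : UnitAddTorus (Fin N × Fin 3) | pairRad L (fromUnitTorusN L t) i j n = 0} = 0 :=
  volume_eq_zero_of_lineSection_countable (i, 0)
    (((continuous_pairRad L i j n).measurable.comp (measurable_fromUnitTorusN L)) (measurableSet_singleton 0))
    fun t => (countable_range _).mono (lineSection_pairRad_eq_zero_subset hL hij n t)

end HardLayerAux

open HardLayerAux in
/-- **A finite-energy function vanishes a.e. on the hard configurations.** Let `v` be measurable with a hard radius,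
`L > 0`, and `η` a function on `(ℝ/ℤ)^{3N}` such that for every coordinate `q = (i, k)` there are `G_q = η` a.e. and
`H_q` with, for a.e. `t`, the ACL property of `G_q` along the `q`-line through `t` (with derivative `H_q`) and locally
finite line potential energy `∫ W(fromUnitTorusN L ·)|G_q|²` along it. Then `η = 0` a.e. on
`fromUnitTorusN L ⁻¹' hardLayer v L 0` (the configurations with an image pair exactly on a hard sphere).
[cite: LSSY2005, Ch. 2, paragraph after eq. (2.1)] -/
theorem ae_eq_zero_of_mem_hardLayer_zero (hL : 0 < L) (hv : Measurable v) (hS : (hardRad v).Nonempty)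
    {η : UnitAddTorus (Fin N × Fin 3) → ℂ} {G H : Fin N × Fin 3 → UnitAddTorus (Fin N × Fin 3) → ℂ}
    (hGη : ∀ q, G q =ᵐ[volume] η)
    (hgood : ∀ q : Fin N × Fin 3, ∀ᵐ t ∂(volume : Measure (UnitAddTorus (Fin N × Fin 3))),
      (∀ a b : ℝ, IntervalIntegrable (fun x : ℝ => H q (t + Pi.single q ((x : ℝ) : UnitAddCircle))) volume a b ∧
        G q (t + Pi.single q ((b : ℝ) : UnitAddCircle)) - G q (t + Pi.single q ((a : ℝ) : UnitAddCircle)) =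
          ∫ x in a..b, H q (t + Pi.single q ((x : ℝ) : UnitAddCircle))) ∧
      (∀ a b : ℝ, ∫⁻ x in Ioo a b, periodicInteraction v L
        (fromUnitTorusN L (t + Pi.single q ((x : ℝ) : UnitAddCircle))) *
          ‖G q (t + Pi.single q ((x : ℝ) : UnitAddCircle))‖ₑ ^ 2 ≠ ⊤)) :
    ∀ᵐ t ∂(volume : Measure (UnitAddTorus (Fin N × Fin 3))),
      fromUnitTorusN L t ∈ (hardLayer v L 0 : Set (Config N)) → η t = 0 := by
  -- on the lines: transversal crossings at parameter `0`
  have key : ∀ (i j : Fin N) (n : Fin 3 → ℤ) (k : Fin 3), i ≠ j →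
      ∀ᵐ t ∂(volume : Measure (UnitAddTorus (Fin N × Fin 3))),
        (pairRad L (fromUnitTorusN L t) i j n ∈ hardRad v ∧
          (fromUnitTorusN L t i - fromUnitTorusN L t j - latticeVec L n) k ≠ 0) → η t = 0 := by
    intro i j n k hij
    filter_upwards [hgood (i, k), hGη (i, k)] with t ht hG
    rintro ⟨hmem, hk⟩
    rw [← hG]
    have h := lineRepr_eq_zero_of_crossing hL hv hij k ht.1 ht.2 n (x₀ := 0)
      (by rw [mul_zero, zero_smul, add_zero]; exact hmem) (by rwa [mul_zero, add_zero])
    simpa using h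
  -- coincidences are null
  have hnull : ∀ (i j : Fin N) (n : Fin 3 → ℤ), i ≠ j →
      ∀ᵐ t ∂(volume : Measure (UnitAddTorus (Fin N × Fin 3))), pairRad L (fromUnitTorusN L t) i j n ≠ 0 := by
    intro i j n hij
    exact measure_eq_zero_iff_ae_notMem.1 (volume_pairRad_eq_zero (N := N) hL hij n)
  -- gather the countably many statements
  have hkey' : ∀ᵐ t ∂(volume : Measure (UnitAddTorus (Fin N × Fin 3))), ∀ (i j : Fin N) (n : Fin 3 → ℤ) (k : Fin 3),
      i ≠ j → (pairRad L (fromUnitTorusN L t) i j n ∈ hardRad v ∧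
        (fromUnitTorusN L t i - fromUnitTorusN L t j - latticeVec L n) k ≠ 0) → η t = 0 := by
    refine ae_all_iff.2 fun i => ae_all_iff.2 fun j => ae_all_iff.2 fun n => ae_all_iff.2 fun k => ?_
    by_cases hij : i = j
    · exact Eventually.of_forall fun t h => absurd hij h
    · filter_upwards [key i j n k hij] with t ht _ using ht
  have hnull' : ∀ᵐ t ∂(volume : Measure (UnitAddTorus (Fin N × Fin 3))), ∀ (i j : Fin N) (n : Fin 3 → ℤ),
      i ≠ j → pairRad L (fromUnitTorusN L t) i j n ≠ 0 := by
    refine ae_all_iff.2 fun i => ae_all_iff.2 fun j => ae_all_iff.2 fun n => ?_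
    by_cases hij : i = j
    · exact Eventually.of_forall fun t h => absurd hij h
    · filter_upwards [hnull i j n hij] with t ht _ using ht
  filter_upwards [hkey', hnull'] with t hK hn
  rintro ⟨i, j, n, hij, hle⟩
  have hmem : pairRad L (fromUnitTorusN L t) i j n ∈ hardRad v :=
    (isClosed_hardRad.mem_iff_infDist_zero hS).2 (le_antisymm hle infDist_nonneg)
  set y : Space := fromUnitTorusN L t i - fromUnitTorusN L t j - latticeVec L n with hy
  obtain ⟨k, hk⟩ := exists_norm_sq_le_three_mul_sq y
  have hy0 : ‖y‖ ≠ 0 := hn i j n hij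
  have hyk : y k ≠ 0 := by
    intro h
    rw [h] at hk
    have : ‖y‖ ^ 2 ≤ 0 := by simpa using hk
    exact hy0 (by nlinarith [norm_nonneg y])
  exact hK i j n k hij ⟨hmem, hyk⟩

end Literature.MathematicalPhysics.QuantumManyBody.BoseGas

end
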